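import Summits.NavierStokesRegularity.FluidComputer.PalasekTowerHeredityWitnessUnconditional

/-!
# REGISTER v2.3′: ONE design's certificate ladder realises the tower — and gives Clay (C) — unconditionally

Cell `ns-blowup`, seat `ns-blowup-ecbridge-6` (g2; D-0074 GROUP C «BRIDGE SUPPORT»; bears_on LADDER-NS
N1, route `PalasekTowerBreakdown`, items stmt-NavierStokesRegularity-19178 `EpisodeInduction`, 19179
`EpisodeBase`, 19249 `HeredityAtOne`). Companion of `PalasekTowerHeredityWitnessUnconditional.lean`
(this seat: THE REDUCTION `Stage.nonempty_extends_of_levelWitness'` — a level witness extends every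
registered stage of its design, NO uniqueness hypothesis) and of lean g4's PATH B′ bridge
`PalasekTowerClayBridgePathB.lean` (`navierStokesBreakdownR3_of_step2_B`, no named fact). LABEL:
E–C typing (KERNEL bookkeeping; theorems only). WHAT THIS IS NOT: not Navier–Stokes evidence — no
schedule, stage, flow or tower is constructed or claimed; the hypotheses below (a registered level-`0`
stage of ONE design plus a level witness of that design at EVERY level) are NOT asserted of anything —
an `ℝ³` forced-NS certificate of even one level is not purchasable with 2026 technology
(HOME/cap/K1R-CAP-PRICE.md), and MODEL tower words are ANALOGUES of level witnesses, never instances;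
nothing here asserts regularity or blow-up.

## What is proved (any rates `R`, any viscosity `ν > 0`; no hypothesis on the schedule class)

The route's two cruxes K1G / K2G quantify over ALL pinned rigid quiet designs (`∃` a prepared design
with a first episode; `∀` designs, heredity at every level). What a certified computation of ONE
design would deliver is different in shape: a registered level-`0` stage of that design (its prepared
host) and, level after level, a LEVEL WITNESS of the same design (`Schedule.LevelWitness S ν k`,
p417894: the design's own classical finite-energy flow from the Clay datum reaches `τ (k+1)` below
`c₂ Y_{k+1}` on the window and shows the three floors of level `k + 1`). This module records that such
a CERTIFICATE LADDER of one design already carries the whole conclusion, with no uniqueness fact and no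
`∀`-over-designs statement in between:

* `Schedule.nonempty_stage_of_levelWitnesses` — the design has a registered stage at every level
  (iterate `Stage.nonempty_extends_of_levelWitness'`);
* `Schedule.nonempty_realisation_of_levelWitnesses` — it realises the tower at viscosity `ν`
  (`Realisation.ofEpisodes` glues the chain of extensions);
* `palasekStep2_of_levelWitnesses` — hence Palasek's Step 2 for the rates `R` (one viscosity gives
  all, `palasekStep2_of_realisation`);
* `navierStokesBreakdownR3_of_levelWitnesses` — hence Fefferman's (C) `NavierStokesBreakdownR3`, by the
  W14-free bridge `navierStokesBreakdownR3_of_step2_B`;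
* wide rates, unit viscosity: `rungG_of_levelWitnesses` (every rung `RungG K` from one pinned rigid
  quiet design's ladder) and `episodeBaseG_of_levelWitnesses`.

So the typed numerical-witness hypothesis of the cell, read for ONE design at ALL levels, is a
sufficient condition for the route's TARGET that sits BESIDE the cruxes (it is implied by
`EpisodeBaseG ∧ EpisodeInductionG` for the base design, `levelWitnesses_of_episodesG`, and implies
neither `∀`-crux). Nothing weaker than the target is claimed to follow; nothing is asserted.

References: S. Palasek, arXiv:2605.13827 §4 [cite: Palasek2026ElementaryModel, §4]; H. Sohr, *The
Navier–Stokes Equations*, Birkhäuser 2001, Ch. V Thm. 1.5.1 [cite: Sohr2001, Ch. V Thm. 1.5.1];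
C. L. Fefferman, Clay problem description, (C) [cite: FeffermanClay2006, (C)].
-/

noncomputable section

namespace Summit.NavierStokesRegularity.FluidComputer.PalasekTowerClayBridge

open Set MeasureTheory Filter Topology Function Real
open scoped ENNReal ContDiff NNReal
open Literature.Analysis.FluidPDE
open Summit.NavierStokesRegularity.NavierStokesRegularity

namespace Schedule

variable {ν : ℝ} {R : TowerRates} (S : Schedule R)

/-- **A certificate ladder gives a registered stage at every level** (any rates, any `ν > 0`): a
registered (routeG) level-`0` stage of the design `S` and a level witness of `S` at every level give a
registered stage of `S` at every level — iterate the unconditional reduction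
`Stage.nonempty_extends_of_levelWitness'`. [cite: Sohr2001, Ch. V Thm. 1.5.1] -/
theorem nonempty_stage_of_levelWitnesses (hν : 0 < ν)
    (hs : Nonempty (Stage ν R S (Margins.routeG R) 0)) (hW : ∀ k, S.LevelWitness ν k) (K : ℕ) :
    Nonempty (Stage ν R S (Margins.routeG R) K) := by
  induction K with
  | zero => exact hs
  | succ K ih =>
    obtain ⟨s⟩ := ih
    obtain ⟨s', -⟩ := s.nonempty_extends_of_levelWitness' hν (hW K)
    exact ⟨s'⟩

/-- **A certificate ladder of ONE design realises the tower** (any rates, any `ν > 0`): a registered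
level-`0` stage of `S` and a level witness of `S` at every level give a `Realisation ν R` — the first
witness extends the host stage to level `1`, the later ones supply the induction step FOR THIS DESIGN
(`Stage.nonempty_extends_of_levelWitness'`), and `Realisation.ofEpisodes` glues the chain.
[cite: Palasek2026ElementaryModel, §4] -/
theorem nonempty_realisation_of_levelWitnesses (hν : 0 < ν)
    (hs : Nonempty (Stage ν R S (Margins.routeG R) 0)) (hW : ∀ k, S.LevelWitness ν k) :
    Nonempty (Realisation ν R) := by
  obtain ⟨s₀⟩ := hs
  obtain ⟨s₁, -⟩ := s₀.nonempty_extends_of_levelWitness' hν (hW 0)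
  exact ⟨Realisation.ofEpisodes S s₁
    (fun n s => s.nonempty_extends_of_levelWitness' hν (hW (n + 1)))⟩

end Schedule

/-- **Palasek's Step 2 from ONE design's certificate ladder** (any rates `R`; one viscosity gives all
by `palasekStep2_of_realisation`). Conditional on the ladder; nothing asserted.
[cite: Palasek2026ElementaryModel, §4] -/
theorem palasekStep2_of_levelWitnesses {ν : ℝ} {R : TowerRates} (hν : 0 < ν) {S : Schedule R}
    (hs : Nonempty (Stage ν R S (Margins.routeG R) 0)) (hW : ∀ k, S.LevelWitness ν k) :
    PalasekStep2 R := by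
  obtain ⟨W⟩ := S.nonempty_realisation_of_levelWitnesses hν hs hW
  exact palasekStep2_of_realisation hν W

/-- **Fefferman's (C) from ONE design's certificate ladder — no named fact, no `∀`-over-designs
crux** (any rates `R`, any `ν > 0`): a schedule `S` with a registered level-`0` stage at viscosity
`ν` whose own flow is a level witness at EVERY level gives `NavierStokesBreakdownR3`, through
`palasekStep2_of_levelWitnesses` and the W14-free bridge `navierStokesBreakdownR3_of_step2_B`
(forced Serrin–Masuda + Tao's forced pressure normalisation, both theorems of the tree). The
hypothesis is the cell's typed numerical-witness hypothesis read for one design at all levels; it is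
NOT asserted (and not purchasable); MODEL words are analogues, never instances.
[cite: FeffermanClay2006, (C)] -/
theorem navierStokesBreakdownR3_of_levelWitnesses {ν : ℝ} {R : TowerRates} (hν : 0 < ν)
    {S : Schedule R} (hs : Nonempty (Stage ν R S (Margins.routeG R) 0))
    (hW : ∀ k, S.LevelWitness ν k) :
    Summit.NavierStokesRegularity.NavierStokesRegularity.NavierStokesBreakdownR3 :=
  navierStokesBreakdownR3_of_step2_B R (palasekStep2_of_levelWitnesses hν hs hW)

/-- The `∃`-packaged form: «some design (any rates) carries a registered level-`0` stage at some
viscosity `ν > 0` and a level witness at every level» ⇒ (C). [cite: FeffermanClay2006, (C)] -/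
theorem navierStokesBreakdownR3_of_exists_levelWitnesses
    (h : ∃ (R : TowerRates) (ν : ℝ) (S : Schedule R), 0 < ν ∧
      Nonempty (Stage ν R S (Margins.routeG R) 0) ∧ ∀ k, S.LevelWitness ν k) :
    Summit.NavierStokesRegularity.NavierStokesRegularity.NavierStokesBreakdownR3 := by
  obtain ⟨R, ν, S, hν, hs, hW⟩ := h
  exact navierStokesBreakdownR3_of_levelWitnesses hν hs hW

/-! ## Wide rates, unit viscosity: the rungs and the base from one design's ladder -/

/-- **Every rung from one pinned rigid quiet design's certificate ladder**: `RungG K` for all `K`.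
[cite: Palasek2026ElementaryModel, §4] -/
theorem rungG_of_levelWitnesses {S : Schedule TowerRates.wide} (hP : S.Pins 8 (6 / 5)) (hR : S.Rigid)
    (hQ : S.Quiet) (hs : Nonempty (Stage 1 TowerRates.wide S (Margins.routeG TowerRates.wide) 0))
    (hW : ∀ k, S.LevelWitness 1 k) (K : ℕ) : RungG K :=
  ⟨S, hP, hR, hQ, S.nonempty_stage_of_levelWitnesses one_pos hs hW K⟩

/-- In particular the base `EpisodeBaseG` (`= RungG 1`) from such a ladder (only the level-`0`
witness is used, cf. `episodeBaseG_of_levelWitness_zero'`). [cite: Palasek2026ElementaryModel, §4] -/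
theorem episodeBaseG_of_levelWitnesses {S : Schedule TowerRates.wide} (hP : S.Pins 8 (6 / 5))
    (hR : S.Rigid) (hQ : S.Quiet)
    (hs : Nonempty (Stage 1 TowerRates.wide S (Margins.routeG TowerRates.wide) 0))
    (hW : ∀ k, S.LevelWitness 1 k) : EpisodeBaseG :=
  rungG_one_iff.1 (rungG_of_levelWitnesses hP hR hQ hs hW 1)

/-- **Converse bookkeeping: the cruxes give a certificate ladder for the base design** (free
direction): under K1G ∧ K2G the design of K1G carries a registered level-`0` stage and a level witness
at every level (restrict / extend its stages and read them as witnesses, `Stage.levelWitness`). So the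
one-design ladder sits between `EpisodeBaseG ∧ EpisodeInductionG` and the target. [folklore] -/
theorem levelWitnesses_of_episodesG (h₁ : EpisodeBaseG) (h₂ : EpisodeInductionG) :
    ∃ S : Schedule TowerRates.wide, S.Pins 8 (6 / 5) ∧ S.Rigid ∧ S.Quiet ∧
      Nonempty (Stage 1 TowerRates.wide S (Margins.routeG TowerRates.wide) 0) ∧
        ∀ k, S.LevelWitness 1 k := by
  obtain ⟨S, hP, hR, hQ, ⟨s₁⟩⟩ := rungG_one_iff.2 h₁
  refine ⟨S, hP, hR, hQ,
    ⟨s₁.restrictOfAntitone (Margins.antitone_routeG TowerRates.wide) (Nat.zero_le 1)⟩, ?_⟩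
  -- stages of `S` at every level `k ≥ 1`, by K2G applied to this design
  have hst : ∀ k, 1 ≤ k → Nonempty (Stage 1 TowerRates.wide S (Margins.routeG TowerRates.wide) k) := by
    intro k hk
    induction k, hk using Nat.le_induction with
    | base => exact ⟨s₁⟩
    | succ k hk ih =>
      obtain ⟨s⟩ := ih
      obtain ⟨s', -⟩ := h₂ S hP hR hQ k hk s
      exact ⟨s'⟩
  intro k
  obtain ⟨s⟩ := hst (k + 1) (Nat.succ_pos k)
  exact s.levelWitness


/-! ## A design that reaches every level realises the tower (appended by ecbridge-6 g2, v2) -/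

/-- **A design with a registered stage at EVERY level realises the tower — no hypothesis** (any
rates, any `ν > 0`): the stage at level `k + 1` is a level witness at level `k`
(`Stage.levelWitness`), so `Schedule.nonempty_realisation_of_levelWitnesses` applies; the
`Stage.Extends` chain needed by `Realisation.ofEpisodes` is produced by the unconditional reduction,
not assumed. So the register asks of ONE design exactly: a registered stage at every level.
[cite: Palasek2026ElementaryModel, §4] -/
theorem Schedule.nonempty_realisation_of_nonempty_stages {ν : ℝ} {R : TowerRates} (S : Schedule R)
    (hν : 0 < ν) (h : ∀ k, Nonempty (Stage ν R S (Margins.routeG R) k)) :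
    Nonempty (Realisation ν R) :=
  S.nonempty_realisation_of_levelWitnesses hν (h 0) fun k => by
    obtain ⟨s⟩ := h (k + 1)
    exact s.levelWitness

/-- **Palasek's Step 2 from ONE design with a registered stage at every level** (any rates; one
viscosity gives all). Conditional on that design; nothing asserted. [cite: Palasek2026ElementaryModel, §4] -/
theorem palasekStep2_of_nonempty_stages {ν : ℝ} {R : TowerRates} (hν : 0 < ν) {S : Schedule R}
    (h : ∀ k, Nonempty (Stage ν R S (Margins.routeG R) k)) : PalasekStep2 R := by
  obtain ⟨W⟩ := S.nonempty_realisation_of_nonempty_stages hν h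
  exact palasekStep2_of_realisation hν W

/-- **Fefferman's (C) from ONE design with a registered stage at every level — no named fact, no
`∀`-over-designs crux** (any rates `R`, any `ν > 0`; through `palasekStep2_of_nonempty_stages` and
the W14-free bridge `navierStokesBreakdownR3_of_step2_B`). The hypothesis is NOT asserted of any
design; MODEL words are analogues, never instances. [cite: FeffermanClay2006, (C)] -/
theorem navierStokesBreakdownR3_of_nonempty_stages {ν : ℝ} {R : TowerRates} (hν : 0 < ν)
    {S : Schedule R} (h : ∀ k, Nonempty (Stage ν R S (Margins.routeG R) k)) :
    Summit.NavierStokesRegularity.NavierStokesRegularity.NavierStokesBreakdownR3 :=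
  navierStokesBreakdownR3_of_step2_B R (palasekStep2_of_nonempty_stages hν h)

/-- Wide rates, unit viscosity: K1G ∧ K2G give such a design (the base design reaches every level),
so `navierStokesBreakdownR3_of_nonempty_stages` re-derives the route's deciding theorem through the
one-design door (free bookkeeping; the route's deciding theorem binds the PATH B′ closer directly).
[folklore] -/
theorem exists_nonempty_stages_of_episodesG (h₁ : EpisodeBaseG) (h₂ : EpisodeInductionG) :
    ∃ S : Schedule TowerRates.wide, S.Pins 8 (6 / 5) ∧ S.Rigid ∧ S.Quiet ∧
      ∀ k, Nonempty (Stage 1 TowerRates.wide S (Margins.routeG TowerRates.wide) k) := by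
  obtain ⟨S, hP, hR, hQ, hs, hW⟩ := levelWitnesses_of_episodesG h₁ h₂
  exact ⟨S, hP, hR, hQ, S.nonempty_stage_of_levelWitnesses one_pos hs hW⟩

end Summit.NavierStokesRegularity.FluidComputer.PalasekTowerClayBridge

end
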